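import Mathlib
import Summits.RiemannHypothesis.RiemannHypothesis.Theorems.WeilFarCoercivityFloor
import HarnessLib

/-!
# The floor is a test quotient plus a perturbation gain: `λ_max(a) ≤ R + B²/(N_c(R − Λ₂))`

Helper file (`--supports stmt-RiemannHypothesis-0098`, lead-track anchor: Weil-positivity window ladder, format-C far bound),
pure proofs.  Seat rh-explicit-weil-1 gen10 (memo `run/shared/lean/pub/rh-explicit/rh-explicit-weil-1/FORMAT-K3.md` §11.13).
NUMERICALLY (kit j224118) the windowed prime-shift form `Q_a` is RANK ONE PLUS BOUNDED: its box-Galerkin spectrum has `λ₁ ≈ e^a` (the floor) and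
`λ₂ ≈ 4.4` (a = 3…8), the maximizer is the cosh profile `c = cosh(x/2)·1_{[−a,a]}` up to an `L²`-angle `1 − cos² ≈ 2e^{−2a}`, and the cosh gap
`λ_max − R_c ≈ 2e^{−a}` (C-XIII″).  This file is the ABSTRACT first-order perturbation bound behind that picture, for ANY admissible direction `c`
(real measurable bounded, vanishing off `[−a,a]`, `N_c = ∫c² > 0`, quotient `R = Q_a(c)/N_c`): IF on the orthocomplement of `c` the form is bounded by
`Λ₂ < R` with coupling constant `B` — hypothesis `hcomp`: `Q_a(αc + w) ≤ α²Q_a(c) + 2|α|B(∫w²)^{1/2} + Λ₂∫w²` for `w ⊥ c` admissible — THEN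
**`λ_max(a) ≤ R + B²/(N_c(R − Λ₂))`** (`farCoercivityFloor_le_quotient_add_of_complement`).  With `c` = the cosh profile this reads: the spectral form
C-XV of the upper clause (`Λ₂ = O(1)`) plus a coupling bound `B = O(√N_c)` give C-XIII″ quantitatively (gain `O(e^{−a})`), hence (under RH,
`WeilFarFloorLawIffCoshGap`) the sharp floor law C-XIII with residual `−Z(a)`.  Standard axioms only.
-/

set_option linter.dupNamespace false
set_option autoImplicit false

noncomputable section

open MeasureTheory Set

namespace Summit.RiemannHypothesis.RiemannHypothesis.Theorems.WeilFormatC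

namespace FloorPerturbation

open Literature.NumberTheory.LFunctions

variable {a : ℝ}

/-- Products of bounded measurable functions, one of them vanishing off `[−a, a]`, are integrable. -/
theorem integrable_mul {u v : ℝ → ℝ} (hu : Measurable u) (hv : Measurable v) {Cu Cv : ℝ}
    (hCu : ∀ x, |u x| ≤ Cu) (hCv : ∀ x, |v x| ≤ Cv) (hsu : ∀ x, x ∉ Icc (-a) a → u x = 0) :
    Integrable (fun x ↦ u x * v x) := by
  have hint : Integrable ((Icc (-a) a).indicator fun _ : ℝ ↦ Cu * Cv) :=
    (integrable_indicator_iff measurableSet_Icc).2 (integrableOn_const (by simp [Real.volume_Icc]))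
  refine hint.mono' (hu.mul hv).aestronglyMeasurable (Filter.Eventually.of_forall fun x ↦ ?_)
  by_cases hx : x ∈ Icc (-a) a
  · rw [indicator_of_mem hx, Real.norm_eq_abs, abs_mul]
    exact mul_le_mul (hCu x) (hCv x) (abs_nonneg _) ((abs_nonneg _).trans (hCu x))
  · rw [indicator_of_notMem hx, hsu x hx, zero_mul, norm_zero]

/-- The elementary discriminant inequality: if `N·δ·(R − Λ₂) = B²` with `N, δ ≥ 0`, `R − Λ₂ ≥ 0`, then
`α²·Q_c + 2|α|B s + Λ₂ s² ≤ (R + δ)(α²N + s²)` for `Q_c = R·N`, `s ≥ 0`. -/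
theorem quad_ineq {N R Λ₂ B δ α s : ℝ} (hN : 0 ≤ N) (hδ : 0 ≤ δ) (hgap : 0 ≤ R - Λ₂) (hs : 0 ≤ s)
    (hkey : N * δ * (R - Λ₂) = B ^ 2) :
    α ^ 2 * (R * N) + 2 * |α| * B * s + Λ₂ * s ^ 2 ≤ (R + δ) * (α ^ 2 * N + s ^ 2) := by
  have hα := abs_nonneg α
  have hsq : α ^ 2 = |α| ^ 2 := (sq_abs α).symm
  set p := Real.sqrt (N * δ) with hp
  set q := Real.sqrt (R - Λ₂) with hq
  have hp2 : p ^ 2 = N * δ := Real.sq_sqrt (mul_nonneg hN hδ)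
  have hq2 : q ^ 2 = R - Λ₂ := Real.sq_sqrt hgap
  have hp0 : 0 ≤ p := Real.sqrt_nonneg _
  have hq0 : 0 ≤ q := Real.sqrt_nonneg _
  have hpq : B ≤ p * q := by
    have h1 : (p * q) ^ 2 = B ^ 2 := by rw [mul_pow, hp2, hq2, ← hkey]
    have h2 : |B| = p * q := by
      rw [← Real.sqrt_sq_eq_abs, ← h1, Real.sqrt_sq (mul_nonneg hp0 hq0)]
    exact (le_abs_self B).trans h2.le
  rw [hsq]
  have hus : 0 ≤ |α| * s := mul_nonneg hα hs
  nlinarith [sq_nonneg (|α| * p - q * s), mul_nonneg hus (sub_nonneg.2 hpq), mul_nonneg hδ (sq_nonneg s), hp2, hq2]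

/-- **The floor is at most a test quotient plus the perturbation gain.**  Let `c` be admissible (measurable, bounded, vanishing off `[−a,a]`,
`N_c = ∫c² > 0`) with quotient `R = Q_a(c)/N_c`, and suppose that for every admissible `w ⊥ c` and every `α`,
`Q_a(αc + w) ≤ α²Q_a(c) + 2|α|·B·(∫w²)^{1/2} + Λ₂·∫w²` with `Λ₂ < R`.  Then `λ_max(a) ≤ R + B²/(N_c(R − Λ₂))`. -/
theorem farCoercivityFloor_le_quotient_add_of_complement (ha : 0 < a) {c : ℝ → ℝ} (hcm : Measurable c) {Cc : ℝ}
    (hCc : ∀ x, |c x| ≤ Cc) (hcs : ∀ x, x ∉ Icc (-a) a → c x = 0) (hNc : 0 < ∫ x, c x ^ 2) {Λ₂ B : ℝ}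
    (hΛ : Λ₂ < primeShiftForm a c / ∫ x, c x ^ 2)
    (hcomp : ∀ (w : ℝ → ℝ) (Cw α : ℝ), Measurable w → (∀ x, |w x| ≤ Cw) → (∀ x, x ∉ Icc (-a) a → w x = 0) →
      ∫ x, w x * c x = 0 →
      primeShiftForm a (fun x ↦ α * c x + w x)
        ≤ α ^ 2 * primeShiftForm a c + 2 * |α| * B * Real.sqrt (∫ x, w x ^ 2) + Λ₂ * ∫ x, w x ^ 2) :
    farCoercivityFloor a ≤ primeShiftForm a c / (∫ x, c x ^ 2)
      + B ^ 2 / ((∫ x, c x ^ 2) * (primeShiftForm a c / (∫ x, c x ^ 2) - Λ₂)) := by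
  set N := ∫ x, c x ^ 2 with hNdef
  set R := primeShiftForm a c / N with hRdef
  set δ := B ^ 2 / (N * (R - Λ₂)) with hδdef
  have hRΛ : 0 < R - Λ₂ := by linarith
  have hδ0 : 0 ≤ δ := div_nonneg (sq_nonneg _) (mul_pos hNc hRΛ).le
  have hkey : N * δ * (R - Λ₂) = B ^ 2 := by
    rw [hδdef]; field_simp
  have hQc : primeShiftForm a c = R * N := by rw [hRdef]; field_simp
  refine farCoercivityFloor_le_of_shiftBound ha fun f Cf hfm hCf hfs ↦ ?_
  -- decompose `f = αc + w` with `w ⊥ c`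
  set α : ℝ := (∫ x, f x * c x) / N with hαdef
  set w : ℝ → ℝ := fun x ↦ f x - α * c x with hwdef
  have hwm : Measurable w := hfm.sub (measurable_const.mul hcm)
  have hCw : ∀ x, |w x| ≤ |Cf| + |α| * |Cc| := fun x ↦ by
    have h1 := hCf x; have h2 := hCc x
    calc |w x| = |f x - α * c x| := rfl
      _ ≤ |f x| + |α * c x| := abs_sub _ _
      _ ≤ |Cf| + |α| * |Cc| := by
        rw [abs_mul]
        exact add_le_add (h1.trans (le_abs_self _)) (mul_le_mul_of_nonneg_left (h2.trans (le_abs_self _)) (abs_nonneg _))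
  have hws : ∀ x, x ∉ Icc (-a) a → w x = 0 := fun x hx ↦ by
    show f x - α * c x = 0
    rw [hfs x hx, hcs x hx]; ring
  -- integrability of the products
  have ifc : Integrable (fun x ↦ f x * c x) := integrable_mul hfm hcm hCf hCc hfs
  have icc : Integrable (fun x ↦ c x * c x) := integrable_mul hcm hcm hCc hCc hcs
  have iwc : Integrable (fun x ↦ w x * c x) := integrable_mul hwm hcm hCw hCc hws
  have iww : Integrable (fun x ↦ w x * w x) := integrable_mul hwm hwm hCw hCw hws
  have iff' : Integrable (fun x ↦ f x * f x) := integrable_mul hfm hfm hCf hCf hfs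
  have hN' : ∫ x, c x * c x = N := by rw [hNdef]; congr 1; funext x; ring
  -- orthogonality `∫ w c = 0`
  have horth : ∫ x, w x * c x = 0 := by
    have : (fun x ↦ w x * c x) = fun x ↦ f x * c x - α * (c x * c x) := by funext x; simp only [hwdef]; ring
    rw [this, integral_sub ifc (icc.const_mul α), integral_const_mul, hN', hαdef]
    field_simp; ring
  -- Pythagoras `∫ f² = α² N + ∫ w²`
  have hpy : ∫ x, f x ^ 2 = α ^ 2 * N + ∫ x, w x ^ 2 := by
    have h1 : (fun x ↦ f x ^ 2) = fun x ↦ α ^ 2 * (c x * c x) + 2 * α * (w x * c x) + w x * w x := by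
      funext x; simp only [hwdef]; ring
    have h2 : (fun x ↦ w x ^ 2) = fun x ↦ w x * w x := by funext x; ring
    have h12 : Integrable (fun x ↦ α ^ 2 * (c x * c x) + 2 * α * (w x * c x)) :=
      (icc.const_mul _).add (iwc.const_mul _)
    have e1 : ∫ x, (α ^ 2 * (c x * c x) + 2 * α * (w x * c x) + w x * w x)
        = (∫ x, (α ^ 2 * (c x * c x) + 2 * α * (w x * c x))) + ∫ x, w x * w x := integral_add h12 iww
    have e2 : ∫ x, (α ^ 2 * (c x * c x) + 2 * α * (w x * c x))
        = (∫ x, α ^ 2 * (c x * c x)) + ∫ x, 2 * α * (w x * c x) := integral_add (icc.const_mul _) (iwc.const_mul _)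
    rw [h1, h2, e1, e2, integral_const_mul, integral_const_mul, hN', horth]
    ring
  -- `f = αc + w` as functions
  have hf : f = fun x ↦ α * c x + w x := by funext x; simp only [hwdef]; ring
  have hW0 : 0 ≤ ∫ x, w x ^ 2 := integral_nonneg fun x ↦ sq_nonneg _
  have hmain := hcomp w (|Cf| + |α| * |Cc|) α hwm hCw hws horth
  rw [← hf] at hmain
  rw [hpy, hQc] at *
  -- the discriminant inequality with `s = √∫w²`
  have hs := Real.sqrt_nonneg (∫ x, w x ^ 2)
  have hss : Real.sqrt (∫ x, w x ^ 2) ^ 2 = ∫ x, w x ^ 2 := Real.sq_sqrt hW0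
  have hq := quad_ineq (α := α) hNc.le hδ0 hRΛ.le hs hkey
  rw [hss] at hq
  show primeShiftForm a f ≤ (R + δ) * (α ^ 2 * N + ∫ x, w x ^ 2)
  linarith

end FloorPerturbation

end Summit.RiemannHypothesis.RiemannHypothesis.Theorems.WeilFormatC
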